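import Summits.QuantumFields.YangMills.Theorems.BalabanUVNodesN11TStepInPrivateCoordinateChart
import Summits.QuantumFields.YangMills.Theorems.BalabanUVNodesN11PrivateChartOfCentralWindow

/-!
# DAG node N11 — THE KERNEL-LEVEL SOCKET ON THE CENTRAL α-WINDOW: def-T's (†) `tstepOfRecord` for ALL new sequences at once, the transport of EVERY density at once,
# the pre-𝐑 slots, the 𝐓-image clause and the first step, with NO per-bond hypothesis displayed — only the SUPPORT CLAUSE «all (0.4) loop variables α-small»

HEADER — WORK-UNIT METADATA.  Cell `pub-ymgap`, YM-PLAN Track A (HUMAN RULING D-0062), seat `pub-ymgap-dag-n08-w2` (g9; WIDTH SEAT 2∕4 on N08 [B10], RE-POINTED to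
N11's [III] §3-supply residue), route `BalabanUVNodes`, key item K1⁷ `StabilityBAtRecordR13SepCoPH` = stmt-QuantumFields-20542 (helper lane, `--kind proof --supports 20542
--as helper` — jail key; K1⁹ stmt-QuantumFields-27364 is the K1-face of record, mis-key rule; count-neutral; (B4)-socket bookkeeping, not a K1-face file).
[I] = [Balaban1987RG1], [III] = [Balaban1988Convergent].  FILE 10 of this seat's kernel-level socket (FILE 1 p611747 · FILE 2 p618553 · FILE 7 p622706
`…N11TStepInPrivateCoordinateChart` · FILE 9 p629182) = trigger (t14) of my g8 HANDOFF = dag-n11-w6 g2's ASK-NEXT offer (o1) «the CENTRAL-WINDOW edition of your kernel-level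
socket», taken by the socket's author.  INHABITANT BY NAME: dag-n11-w6 g2's `…N11PrivateChartOfCentralWindow` (p629018 ✓: `exists_perBondCharts_centralWindow_ac`,
`loops_small_of_plaqSmallOn_blocks`) over dag-n09-w6 g3's `N09CentralWindowAtRecord` (the CENTRAL α-WINDOW `Ωα_c(U) = {g | ∀ i, dist1 (fibreFamily U c (pre·g·post) i) ≤ α}`:
jointly measurable, BLIND to the private coordinates, an INJECTIVITY window of `g ↦ Ū′(c)` for `0 ≤ α ≤ 1∕24`, `α < δ_N`, `offCard c∕|Idx| + 150α < 1`) and pub-balaban's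
`BlockAveragingPlaquetteBoundLocal` (local Stokes bound).

WHY THIS FILE.  FILE 7 typed def-T's (†) ∕ the transport ∕ the pre-𝐑 slots ∕ the 𝐓-image clause ∕ the first step in the PRIVATE-COORDINATE chart modulo DISPLAYED per-bond
inversion data `(Ω, T, ϑ, j; hΩm hTm hθm hjm hΩbl hright hlaw)`.  dag-n11-w6 g2 discharged those data on the central α-window (Lusin–Souslin inverse + kernel Radon–Nikodym
law, no Jacobian continuity, no forward law).  THIS FILE plugs the one into the other: for every small `α` THERE ARE jointly measurable `(T, ϑ, jd)` such that FILE 1's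
KERNEL-LEVEL `hchart` holds at `(fieldMeasure k, fieldMeasure (k+1), avOfRecord)` with constant fibre kernel `dU` and window `Prod.snd ⁻¹' S_α`,
`S_α = {U | ∀ c i, dist1 (loopHol U c i) ≤ α}` («every (0.4) loop variable α-small») — and hence every FILE 2 face with the null set UNIFORM in the density: the transport
of EVERY measurable `ρ` supported in `S_α` at once (no integrability), def-T's (†) `tstepOfRecord … s′ V′` for ALL `s′` at once and the represented tower's pre-𝐑 slots
modulo the SUPPORT CLAUSE «`w_k(s′)(U, V′) ≠ 0 ⇒ U ∈ S_α`» only (what the resummed small-field restrictions (3.2)–(3.5) ∕ `χ_k` are meant to give), the 𝐓-image clause of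
(O3′) and the first step in that currency; §5 restates the support clause in PLAQUETTE currency (`dist1 (U(∂q)) < δ` on the three blocks around every coarse bond,
`((d+2)L)²∕4·δ ≤ α`).  Print's `∫dU δ(ŪV′⁻¹)(…)(U)` ([I] (0.4), [III] (3.1)) as an honest `dU`-integral over the small-loop region, the δ-functions removed by SOLVING
`Ū′(c) = V′(c)` for the central bond variables on dag-n09-w6's window, FOR ALL `s′` AT ONCE.

WHAT THIS FILE PROVES (0 `def`, 0 `sorry`, standard axioms; all BY NAME over FILE 7 + p629018; `k < K`, `0 ≤ α ≤ 1∕24`, `α < δ_N`, `∀ c, offCard c∕|Idx| + 150α < 1`).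
§1 `offCard_gap_of_lt_emlWeight` (the bond-uniform guard `150·α < |Idx|⁻¹ ⇒ offCard c∕|Idx| + 150α < 1`) · `exists_centralWindow_alpha` (admissible `α > 0` exist) ·
`privateDomain_centralWindow_eq` · ★★★ `exists_chart_centralWindow` (FILE 1's `hchart` on the central window — new face; p629018 §1 gives `hpush ∧ hfib`).
§2 ★★ `exists_ae_forall_transportOfRecord_eq_centralWindow` (EVERY density at once).
§3 ★★★ `exists_ae_forall_tstepOfRecord_eq_centralWindow` ((†) ∀ `s′`) · ★★ `exists_ae_forall_slotsTOfRecord₁₃H_succ_eq_centralWindow` (slots + the 𝐓-image clause `iff`, same witnesses).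
§4 ★★ `exists_firstStepIntegralIdentityAt_iff_centralWindow` (`k = 0 < K`).
§5 ★ `exists_ae_forall_tstepOfRecord_eq_of_plaqSmallStepWeights` (support clause in plaquette currency).

HONEST FRAMING.  Helper lane of K1⁷ (aside key); count-neutral; by-name composition (FILE 7 + p629018 + p.-b.'s local Stokes bound); the SUPPORT CLAUSE (loop ∕ plaquette
smallness wherever a step weight ∕ density is non-zero) REMAINS THE HYPOTHESIS — at the record it is what def-R's `χ_k(init s′)` ∕ the (3.3) factors are meant to give, NOT
derived here; the Jacobian is a Radon–Nikodym VERSION (no continuity, no forward law); NO chart of Bałaban's ((47), [III] (3.10)–(3.25)) asserted — a valid chart of the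
disintegration, not print's (dag-n11-e's caveat: (3.23)'s Gaussian form appears only after the latter); nothing of Bałaban ([I] §2, [III] §3, Thm 1–2) asserted; the
predicates of §4 are NOT claimed inhabited for any `θ`; (B4)∕(S-α)∕(O3′) NOT closed; N11 NOT discharged; N08 untouched; K1⁷∕K1⁸∕K1⁹ NOT closed, no registered stub touched;
counts unmoved (typed 28∕28 · discharged 5∕27 · A 5∕28).  One finite `𝕋⁴_{L^K}` programme at fixed `ε = L^{−K}`; R4 closes only the conditional finite-𝕋⁴ rung
`BalabanLadder.UV` — NOT ℝ⁴, NOT OS, NOT a mass gap, NOT Clay.  No `sorry`, `axiom`, `def`, `instance`, `notation`; no local `DecidableEq (PBond …)` binders (p629018's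
bundle is elaborated at the tree's global instance, FILE 7's binders are fed by it).  Sources (SHAPE ∕ bookkeeping only): [I] (0.4) p.253, Thm 1 p.259, (2.9)–(2.10)
pp.266–267; [III] Thm 1 p.262, (2.17) p.257, (3.1) p.264, (3.2)–(3.5) p.265, p.267 L18–24, (3.24)–(3.25) p.270, §3 p.279.
-/

noncomputable section

open MeasureTheory ProbabilityTheory Set Function
open scoped ENNReal NNReal

namespace Summit.QuantumFields.YangMills.Theorems.BalabanUVNodesN11TStepInCentralWindowChart

open Literature.MathematicalPhysics.QuantumFieldTheory.Balaban1983to89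
open Literature.MathematicalPhysics.QuantumFieldTheory.Balaban1983to89.T4AveragingDisintegration
open Literature.MathematicalPhysics.QuantumFieldTheory.Balaban1983to89.BlockAveraging (Small Idx avgFun loopHol)
open Literature.MathematicalPhysics.QuantumFieldTheory.Balaban1983to89.BlockAveragingHaarAC (centralBond pre post centralBond_injective isLocal_avgFun)
open Literature.MathematicalPhysics.QuantumFieldTheory.Balaban1983to89.BlockAveragingEMLHaarAC (fibreFamily offCard offCard_lt_card emlWeight)
open Literature.MathematicalPhysics.QuantumFieldTheory.Balaban1983to89.ExpMeanLog (expMeanLogSU deltaSU deltaSU_pos)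
open BalabanUVNodesN11TStepInPrivateCoordinateChart BalabanUVNodesN11PrivateChartOfCentralWindow
open BalabanUVNodesN11TransportOfRecordInPrivateCoordinateChart (succ_le_m_add_K)
open Summit.QuantumFields.YangMills.BalabanUVNodes.N09CentralWindowAtRecord (measurableSet_centralWindow self_mem_centralWindow_iff)

/-! ## §1  FILE 1's kernel-level `hchart` AT THE RECORD ON THE CENTRAL α-WINDOW — no per-bond hypothesis -/

section Record

open Node00 hiding SU
open T4Continuum

variable {F : T4Family} {N : ℕ} [NeZero N] {K k : ℕ}

omit [NeZero N] in
/-- **THE BOND-UNIFORM α-GUARD.**  At least one (0.4) index at every coarse bond is central (`offCard_lt_card`), so `offCard c∕|Idx| ≤ 1 − |Idx|⁻¹`; hence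
`150·α < |Idx|⁻¹ = emlWeight` gives dag-n09-w6's injectivity guard `offCard c∕|Idx| + 150·α < 1` at EVERY coarse bond (and every level) at once.
[cite: Balaban1987RG1, (0.4) and (0.8) p.253 (bookkeeping: the weights `|I|⁻¹` of the (0.4) average)] -/
theorem offCard_gap_of_lt_emlWeight {α : ℝ} (h150 : 150 * α < emlWeight (F.P K)) (c : PBond (F.P K) (k + 1)) :
    (offCard c : ℝ) / (Fintype.card (Idx (F.P K)) : ℝ) + 150 * α < 1 := by
  have hI : (0 : ℝ) < Fintype.card (Idx (F.P K)) := Nat.cast_pos.mpr Fintype.card_pos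
  have hle : (offCard c : ℝ) ≤ (Fintype.card (Idx (F.P K)) : ℝ) - 1 := by
    have h1 : (offCard c : ℝ) + 1 ≤ Fintype.card (Idx (F.P K)) := by exact_mod_cast offCard_lt_card c
    linarith
  have hdiv : (offCard c : ℝ) / (Fintype.card (Idx (F.P K)) : ℝ) ≤ 1 - emlWeight (F.P K) := by
    rw [emlWeight, div_le_iff₀ hI, sub_mul, inv_mul_cancel₀ hI.ne', one_mul]
    exact hle
  linarith

/-- **ADMISSIBLE α EXIST** (uniformly in the level and the bond): `α := min (1∕24) (min (δ_N∕2) (|Idx|⁻¹∕300))` is positive and meets the three central-window guards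
`α ≤ 1∕24`, `α < δ_N`, `150·α < |Idx|⁻¹`. [cite: Balaban1987RG1, (0.4) p.253 (bookkeeping)] -/
theorem exists_centralWindow_alpha (F : T4Family) (N : ℕ) [NeZero N] (K : ℕ) :
    ∃ α : ℝ, 0 < α ∧ α ≤ 1 / 24 ∧ α < deltaSU (Fin N) ∧ 150 * α < emlWeight (F.P K) := by
  have hδ : 0 < deltaSU (Fin N) := deltaSU_pos
  have hw : 0 < emlWeight (F.P K) := inv_pos.mpr (Nat.cast_pos.mpr Fintype.card_pos)
  refine ⟨min (1 / 24) (min (deltaSU (Fin N) / 2) (emlWeight (F.P K) / 300)), lt_min (by norm_num) (lt_min (by linarith) (by linarith)),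
    min_le_left _ _, ?_, ?_⟩
  · exact (min_le_right _ _).trans_lt ((min_le_left _ _).trans_lt (by linarith))
  · have h3 : min (1 / 24) (min (deltaSU (Fin N) / 2) (emlWeight (F.P K) / 300)) ≤ emlWeight (F.P K) / 300 :=
      (min_le_right _ _).trans (min_le_right _ _)
    linarith

/-- The charted set of the central α-windows in private coordinates IS the small-loop region: `{U | ∀ c, U(β c) ∈ Ωα_c(U)} = {U | ∀ c i, dist1 (loopHol U c i) ≤ α}`
(dag-n09-w6's `self_mem_centralWindow_iff`, bond by bond). [cite: Balaban1987RG1, (0.4) p.253 and (2.9) p.266 (bookkeeping)] -/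
theorem privateDomain_centralWindow_eq (hk : k < K) (α : ℝ) :
    {U : GaugeField (F.P K) k (SU N) | ∀ c : PBond (F.P K) (k + 1), U (centralBond c) ∈
        {g : SU N | ∀ i : Idx (F.P K), dist1 (fibreFamily U c (pre U c * g * post U c) i) ≤ α}} =
      {U | ∀ (c : PBond (F.P K) (k + 1)) (i : Idx (F.P K)), dist1 (loopHol U c i) ≤ α} := by
  ext U
  exact forall_congr' fun c => self_mem_centralWindow_iff (succ_le_m_add_K hk) U c α

/-- **★★★ FILE 1's KERNEL-LEVEL `hchart` AT THE RECORD ON THE CENTRAL α-WINDOW, NO PER-BOND HYPOTHESIS.**  At step `k < K`, for `0 ≤ α ≤ 1∕24`, `α < δ_N` and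
`offCard c∕|Idx| + 150α < 1` at every coarse bond, THERE ARE jointly measurable `(T, ϑ, jd)` — image windows, inverses, Radon–Nikodym densities of dag-n11-w6's per-bond
bundle on dag-n09-w6's central windows — such that, with the CONSTANT fibre kernel `Kernel.const _ dU`, the resampling chart `Ψ(V,U) = extend β (c ↦ ϑ_c(U, V c)) U`, the
Jacobian `J(V,U) = 𝟙[∀ c, V c ∈ T_c(U)]·∏_c jd_c(U, V c)` and the window `Prod.snd ⁻¹' {U | ∀ c i, dist1 (loopHol U c i) ≤ α}` (every (0.4) loop variable α-small):
`((dV ⊗ₘ Kernel.const _ dU)·J).map (z ↦ (z.1, Ψ z)) = (jointLaw dU Ū).restrict (Prod.snd ⁻¹' S_α)` — FILE 7 ★ `chart_privateChart` at p629018 ★★★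
`exists_perBondCharts_centralWindow_ac`.  The socket every FILE 2 ∕ FILE 8 face is keyed on, inhabited with nothing displayed.
[cite: Balaban1987RG1, (0.4) p.253, (2.9)–(2.10) pp.266–267; Balaban1988Convergent, (3.1) p.264, p.267 L18–24; Kechris1995, Thm 15.1] -/
theorem exists_chart_centralWindow (hk : k < K) {α : ℝ} (hα0 : 0 ≤ α) (hα : α ≤ 1 / 24) (hαδ : α < deltaSU (Fin N))
    (hgap : ∀ c : PBond (F.P K) (k + 1), (offCard c : ℝ) / (Fintype.card (Idx (F.P K)) : ℝ) + 150 * α < 1) :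
    ∃ (T : PBond (F.P K) (k + 1) → GaugeField (F.P K) k (SU N) → Set (SU N))
      (ϑ : PBond (F.P K) (k + 1) → GaugeField (F.P K) k (SU N) → SU N → SU N)
      (jd : PBond (F.P K) (k + 1) → GaugeField (F.P K) k (SU N) → SU N → ℝ≥0),
      (∀ c, MeasurableSet {p : GaugeField (F.P K) k (SU N) × SU N | p.2 ∈ T c p.1}) ∧
      (∀ c, Measurable fun p : GaugeField (F.P K) k (SU N) × SU N => ϑ c p.1 p.2) ∧
      (∀ c, Measurable fun p : GaugeField (F.P K) k (SU N) × SU N => jd c p.1 p.2) ∧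
      (((fieldMeasure (F.P K) (k + 1) (SU N)) ⊗ₘ
          (Kernel.const (GaugeField (F.P K) (k + 1) (SU N)) (fieldMeasure (F.P K) k (SU N)))).withDensity (fun z =>
            (({p : GaugeField (F.P K) (k + 1) (SU N) × GaugeField (F.P K) k (SU N) | ∀ c, p.1 c ∈ T c p.2}.indicator
              (fun p => ∏ c, jd c p.2 (p.1 c)) z : ℝ≥0) : ℝ≥0∞))).map
          (fun z => (z.1, (extend centralBond (fun c => ϑ c z.2 (z.1 c)) z.2 : GaugeField (F.P K) k (SU N)))) =
        (jointLaw (fieldMeasure (F.P K) k (SU N)) (avOfRecord F N K k).avg).restrict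
          (Prod.snd ⁻¹' {U : GaugeField (F.P K) k (SU N) | ∀ (c : PBond (F.P K) (k + 1)) (i : Idx (F.P K)), dist1 (loopHol U c i) ≤ α}) := by
  obtain ⟨T, ϑ, jd, hΩm, hΩbl, hTm, hθm, hjm, hright, hlaw, -, -, -⟩ :=
    exists_perBondCharts_centralWindow_ac (F := F) (N := N) hk hα0 hα hαδ hgap
  refine ⟨T, ϑ, jd, hTm, hθm, hjm, ?_⟩
  rw [← privateDomain_centralWindow_eq (F := F) (N := N) hk α]
  exact chart_privateChart (fun c U => {g : SU N | ∀ i : Idx (F.P K), dist1 (fibreFamily U c (pre U c * g * post U c) i) ≤ α})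
    T ϑ jd hk hΩm hTm hθm hjm hΩbl hright hlaw

/-! ## §2  def-T's one-step transport of record on the central window, EVERY DENSITY AT ONCE (no integrability asked) -/

/-- **★★ `transportOfRecord` ON THE CENTRAL α-WINDOW, EVERY DENSITY AT ONCE, NO PER-BOND HYPOTHESIS**: at step `k < K`, for `0 ≤ α ≤ 1∕24`, `α < δ_N`,
`offCard c∕|Idx| + 150α < 1`, THERE ARE jointly measurable `(T, ϑ, jd)` such that for `dV`-a.e. `V` and EVERY measurable density `ρ` with the SUPPORT CLAUSE
«`ρ U ≠ 0 ⇒ ∀ c i, dist1 (loopHol U c i) ≤ α`»: `transportOfRecord F N K k ρ V = ∫ dU 𝟙[∀ c, V c ∈ T_c(U)]·∏_c jd_c(U, V c) · ρ(extend β (ϑ_c(U, V c))_c U)` —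
p629018 ★★★ `exists_chart_transportOfRecord_ae_eq_centralWindow` (ONE integrable `ρ`, `=ᵐ`) with the null set UNIFORM IN `ρ` and no integrability hypothesis
(FILE 7 ★★ `ae_forall_transportOfRecord_eq_privateChart`). [cite: Balaban1988Convergent, (3.1) p.264, p.267 L18–24; Balaban1987RG1, (0.4) p.253, (2.9)–(2.10) pp.266–267] -/
theorem exists_ae_forall_transportOfRecord_eq_centralWindow (hk : k < K) {α : ℝ} (hα0 : 0 ≤ α) (hα : α ≤ 1 / 24) (hαδ : α < deltaSU (Fin N))
    (hgap : ∀ c : PBond (F.P K) (k + 1), (offCard c : ℝ) / (Fintype.card (Idx (F.P K)) : ℝ) + 150 * α < 1) :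
    ∃ (T : PBond (F.P K) (k + 1) → GaugeField (F.P K) k (SU N) → Set (SU N))
      (ϑ : PBond (F.P K) (k + 1) → GaugeField (F.P K) k (SU N) → SU N → SU N)
      (jd : PBond (F.P K) (k + 1) → GaugeField (F.P K) k (SU N) → SU N → ℝ≥0),
      (∀ c, MeasurableSet {p : GaugeField (F.P K) k (SU N) × SU N | p.2 ∈ T c p.1}) ∧
      (∀ c, Measurable fun p : GaugeField (F.P K) k (SU N) × SU N => ϑ c p.1 p.2) ∧
      (∀ c, Measurable fun p : GaugeField (F.P K) k (SU N) × SU N => jd c p.1 p.2) ∧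
      ∀ᵐ V ∂(fieldMeasure (F.P K) (k + 1) (SU N)), ∀ ρ : Density (F.P K) k (SU N), Measurable ρ →
        (∀ U, ρ U ≠ 0 → ∀ (c : PBond (F.P K) (k + 1)) (i : Idx (F.P K)), dist1 (loopHol U c i) ≤ α) →
        transportOfRecord F N K k ρ V = ∫ U,
          (({p : GaugeField (F.P K) (k + 1) (SU N) × GaugeField (F.P K) k (SU N) | ∀ c, p.1 c ∈ T c p.2}.indicator
              (fun p => ∏ c, jd c p.2 (p.1 c)) (V, U) : ℝ≥0) : ℝ) *
            ρ (extend centralBond (fun c => ϑ c U (V c)) U : GaugeField (F.P K) k (SU N)) ∂(fieldMeasure (F.P K) k (SU N)) := by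
  have hkr : k + 1 ≤ (F.P K).m + (F.P K).K := succ_le_m_add_K hk
  obtain ⟨T, ϑ, jd, hΩm, hΩbl, hTm, hθm, hjm, hright, hlaw, -, -, -⟩ :=
    exists_perBondCharts_centralWindow_ac (F := F) (N := N) hk hα0 hα hαδ hgap
  refine ⟨T, ϑ, jd, hTm, hθm, hjm, ?_⟩
  filter_upwards [ae_forall_transportOfRecord_eq_privateChart
    (fun c U => {g : SU N | ∀ i : Idx (F.P K), dist1 (fibreFamily U c (pre U c * g * post U c) i) ≤ α})
    T ϑ jd hk hΩm hTm hθm hjm hΩbl hright hlaw] with V hV ρ hρ hS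
  exact hV ρ hρ fun U hU c => (self_mem_centralWindow_iff hkr U c α).2 (hS U hU c)

end Record

/-! ## §3  def-T's (†) `tstepOfRecord` FOR ALL NEW SEQUENCES AT ONCE and the represented tower's pre-𝐑 slots, on the central window -/

section TStep

open Node00 hiding SU
open T4Continuum

variable {F : T4Family} {N : ℕ} [NeZero N] (p : B12.RunParams) {k : ℕ}

/-- **★★★ def-T's VALUE-LEVEL T-STEP (†) ON THE CENTRAL α-WINDOW, FOR ALL NEW SEQUENCES AT ONCE, NO PER-BOND HYPOTHESIS**: at step `k < K`, for `0 ≤ α ≤ 1∕24`,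
`α < δ_N`, `offCard c∕|Idx| + 150α < 1`, step weights with measurable `U`-sections and the SUPPORT CLAUSE «`w(s′)(U, V′) ≠ 0 ⇒ ∀ c i, dist1 (loopHol U c i) ≤ α`»
(the resummed small-field restrictions (3.2)–(3.5) keep every (0.4) loop variable α-small — DISPLAYED), measurable `χ_k(s)` and `T(s)`: THERE ARE jointly measurable
`(T, ϑ, jd)` such that for `dV′`-a.e. `V′` and EVERY new sequence `s′`,
`(𝐓e^A)_{k+1}(s′)(V′) = ∫ dU 𝟙[∀ c, V′ c ∈ T_c(U)]·∏_c jd_c(U, V′ c) · (w(s′)(·, V′) · χ_k(init s′) · T(init s′))(extend β (ϑ_c(U, V′ c))_c U)` — FILE 7 ★★★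
`ae_forall_tstepOfRecord_eq_privateChart` at p629018's bundle: print's `∫dU δ(ŪV′⁻¹)(…)` with the δ-functions removed by SOLVING `Ū′(c) = V′(c)` on the central windows.
[cite: Balaban1988Convergent, (3.1) p.264, (3.2)–(3.5) p.265, p.267 L18–24; Balaban1987RG1, (0.4) p.253, (2.9)–(2.10) pp.266–267] -/
theorem exists_ae_forall_tstepOfRecord_eq_centralWindow (ν : Stage7Numerics) (M : ℕ) (w : StepWeightsOfRecord F N ν M) (g : ℕ → ℝ) (hk : k < p.K)
    (T' : SeqOfRecord F ν M g p.K k → Density (F.P p.K) k (SU N)) {α : ℝ} (hα0 : 0 ≤ α) (hα : α ≤ 1 / 24) (hαδ : α < deltaSU (Fin N))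
    (hgap : ∀ c : PBond (F.P p.K) (k + 1), (offCard c : ℝ) / (Fintype.card (Idx (F.P p.K)) : ℝ) + 150 * α < 1)
    (hw : ∀ s' V', Measurable fun U => w p g k s' U V') (hχ : ∀ s, Measurable (chiSeqOfRecord F N ν M g p.K k s))
    (hT : ∀ s, Measurable (T' s))
    (hwS : ∀ s' U V', w p g k s' U V' ≠ 0 → ∀ (c : PBond (F.P p.K) (k + 1)) (i : Idx (F.P p.K)), dist1 (loopHol U c i) ≤ α) :
    ∃ (T : PBond (F.P p.K) (k + 1) → GaugeField (F.P p.K) k (SU N) → Set (SU N))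
      (ϑ : PBond (F.P p.K) (k + 1) → GaugeField (F.P p.K) k (SU N) → SU N → SU N)
      (jd : PBond (F.P p.K) (k + 1) → GaugeField (F.P p.K) k (SU N) → SU N → ℝ≥0),
      (∀ c, MeasurableSet {q : GaugeField (F.P p.K) k (SU N) × SU N | q.2 ∈ T c q.1}) ∧
      (∀ c, Measurable fun q : GaugeField (F.P p.K) k (SU N) × SU N => ϑ c q.1 q.2) ∧
      (∀ c, Measurable fun q : GaugeField (F.P p.K) k (SU N) × SU N => jd c q.1 q.2) ∧
      ∀ᵐ V' ∂(fieldMeasure (F.P p.K) (k + 1) (SU N)), ∀ s' : SeqOfRecord F ν M g p.K (k + 1),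
        tstepOfRecord F N ν M w p g k T' s' V' = ∫ U,
          (({q : GaugeField (F.P p.K) (k + 1) (SU N) × GaugeField (F.P p.K) k (SU N) | ∀ c, q.1 c ∈ T c q.2}.indicator
              (fun q => ∏ c, jd c q.2 (q.1 c)) (V', U) : ℝ≥0) : ℝ) *
            (w p g k s' (extend centralBond (fun c => ϑ c U (V' c)) U) V' *
              (chiSeqOfRecord F N ν M g p.K k s'.init (extend centralBond (fun c => ϑ c U (V' c)) U) *
                T' s'.init (extend centralBond (fun c => ϑ c U (V' c)) U))) ∂(fieldMeasure (F.P p.K) k (SU N)) := by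
  have hkr : k + 1 ≤ (F.P p.K).m + (F.P p.K).K := succ_le_m_add_K hk
  obtain ⟨T, ϑ, jd, hΩm, hΩbl, hTm, hθm, hjm, hright, hlaw, -, -, -⟩ :=
    exists_perBondCharts_centralWindow_ac (F := F) (N := N) hk hα0 hα hαδ hgap
  exact ⟨T, ϑ, jd, hTm, hθm, hjm, ae_forall_tstepOfRecord_eq_privateChart p
    (fun c U => {g' : SU N | ∀ i : Idx (F.P p.K), dist1 (fibreFamily U c (pre U c * g' * post U c) i) ≤ α})
    T ϑ jd ν M w g hk T' hΩm hTm hθm hjm hΩbl hright hlaw hw hχ hT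
    fun s' U V' h c => (self_mem_centralWindow_iff hkr U c α).2 (hwS s' U V' h c)⟩

/-- **★★ THE REPRESENTED TOWER'S PRE-𝐑 SLOTS AT LEVEL k+1 AND THE 𝐓-IMAGE CLAUSE ON THE CENTRAL α-WINDOW, STAGE-13 LETTERS, EVERY HISTORY AT ONCE** (the LEFT side of
N11's 𝐓-present child obligation (O3′) «with the δ-functions removed», no per-bond hypothesis): at a v1.7 parameter `θ`, `k < K`, small `α` as above and the SUPPORT CLAUSE
on def-K0a's step weights of record «`w_k(s)(U, V′) ≠ 0 ⇒ ∀ c i, dist1 (loopHol U c i) ≤ α`», THERE ARE jointly measurable `(T, ϑ, jd)` such that (i) for `dV′`-a.e. `V′`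
and every length-(k+1) history `s`, `slotsT_{k+1}(s)(V′) = ∫ dU 𝟙[∀ c, V′ c ∈ T_c(U)]·∏_c jd_c(U, V′ c) · (w_k(s)(·, V′) · χ_k(init s) · slot_k(init s))(extend β (ϑ_c(U, V′ c))_c U)`,
and (ii) for every `s` and every right side `R`, the 𝐓-image clause «`slotsT_{k+1}(s) ≡ 0 ∨` a.e. on `supp χ_{k+1}(s)`: `slotsT_{k+1}(s)(V′) = R V′`» is EQUIVALENT to the
same clause with the chart integral on the left — FILE 7 ★★ `ae_forall_slotsTOfRecord₁₃H_succ_eq_privateChart` ∕ `tImageClause_iff_privateChart` under the SAME witnesses.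
[cite: Balaban1988Convergent, (3.1) p.264, (3.2)–(3.5) p.265, p.267 L18–24, (3.24)–(3.25) p.270, §3 p.279; Balaban1987RG1, (2.9)–(2.10) pp.266–267] -/
theorem exists_ae_forall_slotsTOfRecord₁₃H_succ_eq_centralWindow (θ : Stage13HParams F N) (hk : k < p.K)
    {α : ℝ} (hα0 : 0 ≤ α) (hα : α ≤ 1 / 24) (hαδ : α < deltaSU (Fin N))
    (hgap : ∀ c : PBond (F.P p.K) (k + 1), (offCard c : ℝ) / (Fintype.card (Idx (F.P p.K)) : ℝ) + 150 * α < 1)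
    (hw : ∀ (s : SeqOfRecord F θ.ν θ.τ9.M (gOfRecord₁₃ F N θ.toStage13Params p) p.K (k + 1)) (V' : GaugeField (F.P p.K) (k + 1) (SU N)),
      Measurable fun U => wOfRecord₉ F N θ.toStage9Params p (gOfRecord₁₃ F N θ.toStage13Params p) k s U V')
    (hχ : ∀ s₀ : SeqOfRecord F θ.ν θ.τ9.M (gOfRecord₁₃ F N θ.toStage13Params p) p.K k,
      Measurable (chiSeqOfRecord F N θ.ν θ.τ9.M (gOfRecord₁₃ F N θ.toStage13Params p) p.K k s₀))
    (hslot : ∀ s₀ : SeqOfRecord F θ.ν θ.τ9.M (gOfRecord₁₃ F N θ.toStage13Params p) p.K k,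
      Measurable (slotsOfRecord F N θ.ν θ.τ9 (EOfRecord₁₃ F N θ.toStage13Params) (wOfRecord₉ F N θ.toStage9Params) θ.ppSel p (gOfRecord₁₃ F N θ.toStage13Params p) k s₀))
    (hwS : ∀ (s : SeqOfRecord F θ.ν θ.τ9.M (gOfRecord₁₃ F N θ.toStage13Params p) p.K (k + 1)) (U : GaugeField (F.P p.K) k (SU N))
      (V' : GaugeField (F.P p.K) (k + 1) (SU N)),
      wOfRecord₉ F N θ.toStage9Params p (gOfRecord₁₃ F N θ.toStage13Params p) k s U V' ≠ 0 →
        ∀ (c : PBond (F.P p.K) (k + 1)) (i : Idx (F.P p.K)), dist1 (loopHol U c i) ≤ α) :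
    ∃ (T : PBond (F.P p.K) (k + 1) → GaugeField (F.P p.K) k (SU N) → Set (SU N))
      (ϑ : PBond (F.P p.K) (k + 1) → GaugeField (F.P p.K) k (SU N) → SU N → SU N)
      (jd : PBond (F.P p.K) (k + 1) → GaugeField (F.P p.K) k (SU N) → SU N → ℝ≥0),
      (∀ c, MeasurableSet {q : GaugeField (F.P p.K) k (SU N) × SU N | q.2 ∈ T c q.1}) ∧
      (∀ c, Measurable fun q : GaugeField (F.P p.K) k (SU N) × SU N => ϑ c q.1 q.2) ∧
      (∀ c, Measurable fun q : GaugeField (F.P p.K) k (SU N) × SU N => jd c q.1 q.2) ∧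
      (∀ᵐ V' ∂(fieldMeasure (F.P p.K) (k + 1) (SU N)), ∀ s : SeqOfRecord F θ.ν θ.τ9.M (gOfRecord₁₃ F N θ.toStage13Params p) p.K (k + 1),
        slotsTOfRecord F N θ.ν θ.τ9 (EOfRecord₁₃ F N θ.toStage13Params) (wOfRecord₉ F N θ.toStage9Params) θ.ppSel p (gOfRecord₁₃ F N θ.toStage13Params p) (k + 1) s V' =
          ∫ U, (({q : GaugeField (F.P p.K) (k + 1) (SU N) × GaugeField (F.P p.K) k (SU N) | ∀ c, q.1 c ∈ T c q.2}.indicator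
              (fun q => ∏ c, jd c q.2 (q.1 c)) (V', U) : ℝ≥0) : ℝ) *
            (wOfRecord₉ F N θ.toStage9Params p (gOfRecord₁₃ F N θ.toStage13Params p) k s (extend centralBond (fun c => ϑ c U (V' c)) U) V' *
              (chiSeqOfRecord F N θ.ν θ.τ9.M (gOfRecord₁₃ F N θ.toStage13Params p) p.K k s.init (extend centralBond (fun c => ϑ c U (V' c)) U) *
                slotsOfRecord F N θ.ν θ.τ9 (EOfRecord₁₃ F N θ.toStage13Params) (wOfRecord₉ F N θ.toStage9Params) θ.ppSel p (gOfRecord₁₃ F N θ.toStage13Params p) k s.init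
                  (extend centralBond (fun c => ϑ c U (V' c)) U))) ∂(fieldMeasure (F.P p.K) k (SU N))) ∧
      ∀ (s : SeqOfRecord F θ.ν θ.τ9.M (gOfRecord₁₃ F N θ.toStage13Params p) p.K (k + 1)) (R : GaugeField (F.P p.K) (k + 1) (SU N) → ℝ),
        (slotsTOfRecord F N θ.ν θ.τ9 (EOfRecord₁₃ F N θ.toStage13Params) (wOfRecord₉ F N θ.toStage9Params) θ.ppSel p (gOfRecord₁₃ F N θ.toStage13Params p) (k + 1) s = 0 ∨
          ∀ᵐ V' ∂fieldMeasure (F.P p.K) (k + 1) (SU N),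
            chiSeqOfRecord F N θ.ν θ.τ9.M (gOfRecord₁₃ F N θ.toStage13Params p) p.K (k + 1) s V' ≠ 0 →
              slotsTOfRecord F N θ.ν θ.τ9 (EOfRecord₁₃ F N θ.toStage13Params) (wOfRecord₉ F N θ.toStage9Params) θ.ppSel p (gOfRecord₁₃ F N θ.toStage13Params p) (k + 1) s V' =
                R V') ↔
        (slotsTOfRecord F N θ.ν θ.τ9 (EOfRecord₁₃ F N θ.toStage13Params) (wOfRecord₉ F N θ.toStage9Params) θ.ppSel p (gOfRecord₁₃ F N θ.toStage13Params p) (k + 1) s = 0 ∨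
          ∀ᵐ V' ∂fieldMeasure (F.P p.K) (k + 1) (SU N),
            chiSeqOfRecord F N θ.ν θ.τ9.M (gOfRecord₁₃ F N θ.toStage13Params p) p.K (k + 1) s V' ≠ 0 →
              ∫ U, (({q : GaugeField (F.P p.K) (k + 1) (SU N) × GaugeField (F.P p.K) k (SU N) | ∀ c, q.1 c ∈ T c q.2}.indicator
                  (fun q => ∏ c, jd c q.2 (q.1 c)) (V', U) : ℝ≥0) : ℝ) *
                (wOfRecord₉ F N θ.toStage9Params p (gOfRecord₁₃ F N θ.toStage13Params p) k s (extend centralBond (fun c => ϑ c U (V' c)) U) V' *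
                  (chiSeqOfRecord F N θ.ν θ.τ9.M (gOfRecord₁₃ F N θ.toStage13Params p) p.K k s.init (extend centralBond (fun c => ϑ c U (V' c)) U) *
                    slotsOfRecord F N θ.ν θ.τ9 (EOfRecord₁₃ F N θ.toStage13Params) (wOfRecord₉ F N θ.toStage9Params) θ.ppSel p (gOfRecord₁₃ F N θ.toStage13Params p) k
                      s.init (extend centralBond (fun c => ϑ c U (V' c)) U))) ∂(fieldMeasure (F.P p.K) k (SU N)) = R V') := by
  have hkr : k + 1 ≤ (F.P p.K).m + (F.P p.K).K := succ_le_m_add_K hk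
  obtain ⟨T, ϑ, jd, hΩm, hΩbl, hTm, hθm, hjm, hright, hlaw, -, -, -⟩ :=
    exists_perBondCharts_centralWindow_ac (F := F) (N := N) hk hα0 hα hαδ hgap
  have hwΩ : ∀ (s : SeqOfRecord F θ.ν θ.τ9.M (gOfRecord₁₃ F N θ.toStage13Params p) p.K (k + 1)) (U : GaugeField (F.P p.K) k (SU N))
      (V' : GaugeField (F.P p.K) (k + 1) (SU N)),
      wOfRecord₉ F N θ.toStage9Params p (gOfRecord₁₃ F N θ.toStage13Params p) k s U V' ≠ 0 →
        ∀ c, U (centralBond c) ∈ {g' : SU N | ∀ i : Idx (F.P p.K), dist1 (fibreFamily U c (pre U c * g' * post U c) i) ≤ α} :=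
    fun s U V' h c => (self_mem_centralWindow_iff hkr U c α).2 (hwS s U V' h c)
  exact ⟨T, ϑ, jd, hTm, hθm, hjm,
    ae_forall_slotsTOfRecord₁₃H_succ_eq_privateChart p
      (fun c U => {g' : SU N | ∀ i : Idx (F.P p.K), dist1 (fibreFamily U c (pre U c * g' * post U c) i) ≤ α})
      T ϑ jd θ hk hΩm hTm hθm hjm hΩbl hright hlaw hw hχ hslot hwΩ,
    fun s R => tImageClause_iff_privateChart p
      (fun c U => {g' : SU N | ∀ i : Idx (F.P p.K), dist1 (fibreFamily U c (pre U c * g' * post U c) i) ≤ α})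
      T ϑ jd θ hk hΩm hTm hθm hjm hΩbl hright hlaw hw hχ hslot hwΩ s R⟩

/-! ## §5  The support clause in PLAQUETTE currency -/

/-- **★ def-T's (†) ON THE CENTRAL WINDOW WITH THE SUPPORT CLAUSE IN PLAQUETTE CURRENCY**: as ★★★ `exists_ae_forall_tstepOfRecord_eq_centralWindow`, the support clause
now reading «wherever `w(s′)(U, V′) ≠ 0`, every fine plaquette based in the three blocks `B(c₋ − e_μ) ∪ B(c₋) ∪ B(c₊)` around EVERY coarse bond `c` is within `δ` of `1`»
with `0 ≤ δ`, `((d+2)L)²∕4 · δ ≤ α` — the shape in which the small-field characteristic functions of (2.17) ∕ (3.3) constrain the step weights (p629018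
`loops_small_of_plaqSmallOn_blocks` = pub-balaban's local Stokes bound). [cite: Balaban1988Convergent, (2.17) p.257, (3.1) p.264, (3.3) p.265, p.267 L18–24; Balaban1987RG1, (0.4) p.253, (2.9) p.266] -/
theorem exists_ae_forall_tstepOfRecord_eq_of_plaqSmallStepWeights (ν : Stage7Numerics) (M : ℕ) (w : StepWeightsOfRecord F N ν M) (g : ℕ → ℝ) (hk : k < p.K)
    (T' : SeqOfRecord F ν M g p.K k → Density (F.P p.K) k (SU N)) {α : ℝ} (hα0 : 0 ≤ α) (hα : α ≤ 1 / 24) (hαδ : α < deltaSU (Fin N))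
    (hgap : ∀ c : PBond (F.P p.K) (k + 1), (offCard c : ℝ) / (Fintype.card (Idx (F.P p.K)) : ℝ) + 150 * α < 1)
    {δ : ℝ} (hδ : 0 ≤ δ) (hδα : ((((F.P p.K).d + 2) * (F.P p.K).L : ℕ) : ℝ) ^ 2 / 4 * δ ≤ α)
    (hw : ∀ s' V', Measurable fun U => w p g k s' U V') (hχ : ∀ s, Measurable (chiSeqOfRecord F N ν M g p.K k s))
    (hT : ∀ s, Measurable (T' s))
    (hwq : ∀ s' U V', w p g k s' U V' ≠ 0 → ∀ (c : PBond (F.P p.K) (k + 1)) (q : Plaq (F.P p.K) k),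
      (blockOf q.src = c.src.unshift c.dir ∨ blockOf q.src = c.src ∨ blockOf q.src = c.tgt) → dist1 (GaugeField.plaqHol U q) < δ) :
    ∃ (T : PBond (F.P p.K) (k + 1) → GaugeField (F.P p.K) k (SU N) → Set (SU N))
      (ϑ : PBond (F.P p.K) (k + 1) → GaugeField (F.P p.K) k (SU N) → SU N → SU N)
      (jd : PBond (F.P p.K) (k + 1) → GaugeField (F.P p.K) k (SU N) → SU N → ℝ≥0),
      (∀ c, MeasurableSet {q : GaugeField (F.P p.K) k (SU N) × SU N | q.2 ∈ T c q.1}) ∧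
      (∀ c, Measurable fun q : GaugeField (F.P p.K) k (SU N) × SU N => ϑ c q.1 q.2) ∧
      (∀ c, Measurable fun q : GaugeField (F.P p.K) k (SU N) × SU N => jd c q.1 q.2) ∧
      ∀ᵐ V' ∂(fieldMeasure (F.P p.K) (k + 1) (SU N)), ∀ s' : SeqOfRecord F ν M g p.K (k + 1),
        tstepOfRecord F N ν M w p g k T' s' V' = ∫ U,
          (({q : GaugeField (F.P p.K) (k + 1) (SU N) × GaugeField (F.P p.K) k (SU N) | ∀ c, q.1 c ∈ T c q.2}.indicator
              (fun q => ∏ c, jd c q.2 (q.1 c)) (V', U) : ℝ≥0) : ℝ) *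
            (w p g k s' (extend centralBond (fun c => ϑ c U (V' c)) U) V' *
              (chiSeqOfRecord F N ν M g p.K k s'.init (extend centralBond (fun c => ϑ c U (V' c)) U) *
                T' s'.init (extend centralBond (fun c => ϑ c U (V' c)) U))) ∂(fieldMeasure (F.P p.K) k (SU N)) :=
  exists_ae_forall_tstepOfRecord_eq_centralWindow p ν M w g hk T' hα0 hα hαδ hgap hw hχ hT fun s' U V' h c i =>
    loops_small_of_plaqSmallOn_blocks (succ_le_m_add_K hk) hδ hδα U c (hwq s' U V' h c) i

end TStep

/-! ## §4  The FIRST renormalization step (`k = 0 < K`) on the central window -/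

section FirstStep

open scoped Matrix.Norms.L2Operator
open Node00 hiding SU
open T4Continuum Node00.Tk Step
open BalabanUVNodesN11FirstStepSupply

variable {F : T4Family} {N : ℕ} [NeZero N] (p : B12.RunParams)

/-- **★★ THE FIRST RENORMALIZATION STEP ON THE CENTRAL α-WINDOW, NO PER-BOND HYPOTHESIS**: at a v1.7 parameter `θ`, `0 < K`, small `α` (`0 ≤ α ≤ 1∕24`, `α < δ_N`,
`offCard c∕|Idx| + 150α < 1` at every level-1 bond) and the SUPPORT CLAUSE on the level-0 step weights «`w₀(s)(U, V′) ≠ 0 ⇒ ∀ c i, dist1 (loopHol U c i) ≤ α`»,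
THERE ARE jointly measurable `(T, ϑ, jd)` such that this seat's `FirstStepIntegralIdentityAt θ p` (`↔ FirstStepSupplyAt θ p ↔` dag-n11-e's `Sect3SpliceSupplyAt θ p 0`;
g0 p588912) is EQUIVALENT to the same predicate with the 𝐓-image clause (iii′) written as an honest `dU`-integral over the small-loop region: EITHER `slotsT₁(s) ≡ 0`, OR
for `dV′`-a.e. `V′` on `supp χ₁(s)`, `∫ dU 𝟙[∀ c, V′ c ∈ T_c(U)]·∏_c jd_c(U, V′ c) · w₀(s)(Ψ(V′,U), V′) · ρ₀(Ψ(V′,U)) = 𝐓₁(s)[W(s)] (exp A₁(s)[u s, E₁ s]) (V′)` —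
[I] Thm 1's first step `𝐓ρ₀ = 𝐓₁ exp A₁` with the δ-functions removed by SOLVING `Ū′(c) = V′(c)` on dag-n09-w6's central windows (FILE 7 ★★★
`firstStepIntegralIdentityAt_iff_privateChart` at p629018's level-0 bundle).  A predicate-level equivalence — NOT claimed inhabited for any `θ`.
[cite: Balaban1987RG1, Thm 1 p.259, (0.24)–(0.27) p.257, (2.9)–(2.10) pp.266–267; Balaban1988Convergent, Thm 1 p.262, (3.1) p.264, (3.24)–(3.25) p.270, p.267 L18–24] -/
theorem exists_firstStepIntegralIdentityAt_iff_centralWindow (θ : Stage13HParams F N) (hK : 0 < p.K)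
    {α : ℝ} (hα0 : 0 ≤ α) (hα : α ≤ 1 / 24) (hαδ : α < deltaSU (Fin N))
    (hgap : ∀ c : PBond (F.P p.K) (0 + 1), (offCard c : ℝ) / (Fintype.card (Idx (F.P p.K)) : ℝ) + 150 * α < 1)
    (hw : ∀ (s : SeqOfRecord F θ.ν θ.τ9.M (gOfRecord₁₃ F N θ.toStage13Params p) p.K 1) (V' : GaugeField (F.P p.K) 1 (SU N)),
      Measurable fun U => wOfRecord₉ F N θ.toStage9Params p (gOfRecord₁₃ F N θ.toStage13Params p) 0 s U V')
    (hwS : ∀ (s : SeqOfRecord F θ.ν θ.τ9.M (gOfRecord₁₃ F N θ.toStage13Params p) p.K 1) (U : GaugeField (F.P p.K) 0 (SU N)) (V' : GaugeField (F.P p.K) 1 (SU N)),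
      wOfRecord₉ F N θ.toStage9Params p (gOfRecord₁₃ F N θ.toStage13Params p) 0 s U V' ≠ 0 →
        ∀ (c : PBond (F.P p.K) (0 + 1)) (i : Idx (F.P p.K)), dist1 (loopHol U c i) ≤ α) :
    ∃ (T : PBond (F.P p.K) (0 + 1) → GaugeField (F.P p.K) 0 (SU N) → Set (SU N))
      (ϑ : PBond (F.P p.K) (0 + 1) → GaugeField (F.P p.K) 0 (SU N) → SU N → SU N)
      (jd : PBond (F.P p.K) (0 + 1) → GaugeField (F.P p.K) 0 (SU N) → SU N → ℝ≥0),
      (∀ c, MeasurableSet {q : GaugeField (F.P p.K) 0 (SU N) × SU N | q.2 ∈ T c q.1}) ∧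
      (∀ c, Measurable fun q : GaugeField (F.P p.K) 0 (SU N) × SU N => ϑ c q.1 q.2) ∧
      (∀ c, Measurable fun q : GaugeField (F.P p.K) 0 (SU N) × SU N => jd c q.1 q.2) ∧
      (FirstStepIntegralIdentityAt θ p ↔
      ∃ (u : SeqOfRecord F θ.ν θ.τ9.M (gOfRecord₁₃ F N θ.toStage13Params p) p.K 1 → Sect2.TermValues (F.P p.K) (MatA N) (FluctV N) θ.τ9.M)
        (E₁ : SeqOfRecord F θ.ν θ.τ9.M (gOfRecord₁₃ F N θ.toStage13Params p) p.K 1 → ℝ),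
        Sect2.UniversalE u ∧
        ∀ s : SeqOfRecord F θ.ν θ.τ9.M (gOfRecord₁₃ F N θ.toStage13Params p) p.K 1, s.Ω 1 ≠ ∅ →
          Step.LFNewTerms (sect2TowerOfRecord F N (FluctV N) p.K (settingOfRecord₁₃ F N θ.toStage13Params p) (θ.rzAt p s) s (u s))
            (settingOfRecord₁₃ F N θ.toStage13Params p).lf (settingOfRecord₁₃ F N θ.toStage13Params p).βc 0 ∧
          (∀ (X : (Sect2.domSys (F.P p.K) θ.τ9.M 1).Dom) (z : Site (F.P p.K) 1) (g : ℝ), 0 ≤ g → g ≤ (settingOfRecord₁₃ F N θ.toStage13Params p).lf.γ →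
            AnalyticOnNhd ℂ ((u s).E 1 X z g)
              ((sect2TowerOfRecord F N (FluctV N) p.K (settingOfRecord₁₃ F N θ.toStage13Params p) (θ.rzAt p s) s (u s)).space 1 X
                ((settingOfRecord₁₃ F N θ.toStage13Params p).lf.alpha0 ((settingOfRecord₁₃ F N θ.toStage13Params p).flow.g 1))
                ((settingOfRecord₁₃ F N θ.toStage13Params p).lf.alpha1 ((settingOfRecord₁₃ F N θ.toStage13Params p).flow.g 1)))) ∧
          (∀ X : (Sect2.domSys (F.P p.K) θ.τ9.M 1).Dom,
            AnalyticOnNhd ℂ ((u s).R 1 X)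
              ((sect2TowerOfRecord F N (FluctV N) p.K (settingOfRecord₁₃ F N θ.toStage13Params p) (θ.rzAt p s) s (u s)).space 1 X
                ((settingOfRecord₁₃ F N θ.toStage13Params p).lf.alpha0 ((settingOfRecord₁₃ F N θ.toStage13Params p).flow.g 1))
                ((settingOfRecord₁₃ F N θ.toStage13Params p).lf.alpha1 ((settingOfRecord₁₃ F N θ.toStage13Params p).flow.g 1)))) ∧
          (∀ (X : (Sect2.domSys (F.P p.K) θ.τ9.M 1).Dom) (a : SFluct (F.P p.K) (FluctV N)),
            AnalyticOnNhd ℂ (fun φ => (u s).B 1 X φ a)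
              ((sect2TowerOfRecord F N (FluctV N) p.K (settingOfRecord₁₃ F N θ.toStage13Params p) (θ.rzAt p s) s (u s)).spaceB 1 X)) ∧
          -- (iii⁗) the 𝐓-image identity of the first step ON THE CENTRAL α-WINDOW
          (slotsTOfRecord F N θ.ν θ.τ9 (EOfRecord₁₃ F N θ.toStage13Params) (wOfRecord₉ F N θ.toStage9Params) θ.ppSel p
              (gOfRecord₁₃ F N θ.toStage13Params p) 1 s = 0 ∨
            ∀ᵐ V' ∂fieldMeasure (F.P p.K) 1 (SU N),
              chiSeqOfRecord F N θ.ν θ.τ9.M (gOfRecord₁₃ F N θ.toStage13Params p) p.K 1 s V' ≠ 0 →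
                ∫ U, (({q : GaugeField (F.P p.K) (0 + 1) (SU N) × GaugeField (F.P p.K) 0 (SU N) | ∀ c, q.1 c ∈ T c q.2}.indicator
                    (fun q => ∏ c, jd c q.2 (q.1 c)) (V', U) : ℝ≥0) : ℝ) *
                  (wOfRecord₉ F N θ.toStage9Params p (gOfRecord₁₃ F N θ.toStage13Params p) 0 s (extend centralBond (fun c => ϑ c U (V' c)) U) V' *
                    rhoZeroOfRecord F N p.K (gOfRecord₁₃ F N θ.toStage13Params p 0) (EOfRecord₁₃ F N θ.toStage13Params p)
                      (extend centralBond (fun c => ϑ c U (V' c)) U)) ∂(fieldMeasure (F.P p.K) 0 (SU N)) =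
                  TkOfRecord F N (FluctV N) θ.ν θ.τ9.M (gOfRecord₁₃ F N θ.toStage13Params p) p.K (WtOfRecord₁₃H F N θ p s) 1 s
                    (sect2Operand F N (FluctV N) p.K (settingOfRecord₁₃ F N θ.toStage13Params p) (θ.rzAt p s) s (u s) (E₁ s)
                      (UbgOfRecord₁₃CoP F N θ.toStage13Params p 1 s)) V')) := by
  have hkr : 0 + 1 ≤ (F.P p.K).m + (F.P p.K).K := succ_le_m_add_K hK
  obtain ⟨T, ϑ, jd, hΩm, hΩbl, hTm, hθm, hjm, hright, hlaw, -, -, -⟩ :=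
    exists_perBondCharts_centralWindow_ac (F := F) (N := N) (k := 0) hK hα0 hα hαδ hgap
  exact ⟨T, ϑ, jd, hTm, hθm, hjm, firstStepIntegralIdentityAt_iff_privateChart p
    (fun c U => {g' : SU N | ∀ i : Idx (F.P p.K), dist1 (fibreFamily U c (pre U c * g' * post U c) i) ≤ α})
    T ϑ jd θ hK hΩm hTm hθm hjm hΩbl hright hlaw hw
    fun s U V' h c => (self_mem_centralWindow_iff hkr U c α).2 (hwS s U V' h c)⟩

end FirstStep

end Summit.QuantumFields.YangMills.Theorems.BalabanUVNodesN11TStepInCentralWindowChart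

end
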